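import Summits.QuantumFields.QCD.Theorems.QuarksAsStableActionStableActionBridgeFermionSlicePosDef

/-!
# Hermitian symmetry of the transfer form and of the `T̂_F`-weighted pairing of lattice QCD
(crux `QuarksAsStableAction.StableActionBridge`, item stmt-QuantumFields-9737, line `Sketch`;
registered stubs `transferForm_conj_symm` and `fermionWeightForm_conj_symm` of the lead skeleton,
cycle 6: the form-level self-adjointness of Lüscher's transfer operator)

Lüscher's one-step transfer operator of Wilson's lattice QCD with `r = 1` quarks,
`T̂ = T̂_F^{1/2} T̂_U T̂_F^{1/2}` (Smit (6.87)), is rendered in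
`Literature/MathematicalPhysics/QuantumFieldTheory/QCDTransferMatrix.lean` WITHOUT operator theory,
through two sesquilinear forms on Fock-vector-valued wave functions `Φ, Ψ : SU(3)^{links} → Fock`
of one time slice of the spatial three-torus:

* the `T̂_F`-weighted pairing `𝔫(Φ, Ψ) = ∫ ⟨Φ(U), T̂_F(U) Ψ(U)⟩ dU` (`fermionWeightForm`), and
* the transfer form `𝔱(Φ, Ψ) = ∫∫ K_β(U, U') ⟨T̂_F(U) Φ(U), T̂_F(U') Ψ(U')⟩ dU dU'` (`transferForm`),

whose ratio on the diagonal is the Rayleigh quotient behind `qcdTransferLevel` / `qcdTransferGap`.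
"`T̂` is self-adjoint" at this form level is the statement that both forms are Hermitian:

* `fermionWeightForm_conj_symm`: for all bare masses `m_f > −1`, `𝔫(Φ, Ψ) = conj 𝔫(Ψ, Φ)` for
  ALL wave functions — pointwise `conj ⟨Ψ(U), T̂_F Φ(U)⟩ = ⟨T̂_F Φ(U), Ψ(U)⟩ = ⟨Φ(U), T̂_Fᴴ Ψ(U)⟩`
  and `T̂_F(U)ᴴ = T̂_F(U)` because `T̂_F(U)` is Hermitian positive definite for `m_f > −1`
  (`fermionSliceOp_posDef`, Lüscher positivity); then `∫ conj = conj ∫` (no integrability needed).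
* `transferForm_conj_symm`: `𝔱(Φ, Ψ) = conj 𝔱(Ψ, Φ)` for continuous `Φ, Ψ`, given continuity of
  `U ↦ T̂_F(U)`: pointwise `conj ⟨a, b⟩ = ⟨b, a⟩`, the kernel is real and symmetric
  (`gaugeSliceKernel_symm`, `K_β(U, U') = K_β(U', U)`), and the two Haar integrals are exchanged by
  Fubini — the integrand is continuous on the compact product `SU(3)^{links} × SU(3)^{links}`, hence
  bounded and integrable for the product of the two Haar probability measures.

References: M. Lüscher, Commun. Math. Phys. 54 (1977) 283 [cite: Luscher1977, pp. 283–292];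
J. Smit, *Introduction to Quantum Fields on a Lattice* (2023), §6.5 (6.87) and §4.6 (4.129)
[cite: Smit2023, §6.5 (6.87)].  Pure theorem file (no definitions).
-/

noncomputable section

namespace Summit.QuantumFields.QCD.Cruxes.StableActionBridge.Sketch

open scoped ComplexOrder
open MeasureTheory Matrix
open Literature.MathematicalPhysics.QuantumFieldTheory Literature.MathematicalPhysics.QuantumLattice

/-- `conj ⟨a, b⟩ = ⟨b, a⟩` for the Fock inner product `⟨a, b⟩ = star a ⬝ᵥ b` on `ι → ℂ`. [folklore] -/
private theorem conj_star_dotProduct {ι : Type*} [Fintype ι] (a b : ι → ℂ) :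
    (starRingEnd ℂ) (star a ⬝ᵥ b) = star b ⬝ᵥ a := by
  rw [starRingEnd_apply]
  exact (Matrix.star_dotProduct b a).symm

/-- For a Hermitian matrix `T`, `conj ⟨a, T b⟩ = ⟨b, T a⟩` (`⟨u, v⟩ = star u ⬝ᵥ v`). [folklore] -/
private theorem conj_star_dotProduct_mulVec_of_isHermitian {ι : Type*} [Fintype ι]
    {T : Matrix ι ι ℂ} (hT : T.IsHermitian) (a b : ι → ℂ) :
    (starRingEnd ℂ) (star a ⬝ᵥ (T *ᵥ b)) = star b ⬝ᵥ (T *ᵥ a) := by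
  rw [conj_star_dotProduct, Matrix.star_mulVec, ← Matrix.dotProduct_mulVec, hT.eq]

/-- A continuous complex-valued function on a compact space is integrable for every finite Borel
measure (it is bounded and strongly measurable). [folklore] -/
private theorem integrable_of_continuous_of_compactSpace {X : Type*} [TopologicalSpace X]
    [MeasurableSpace X] [OpensMeasurableSpace X] [CompactSpace X] {μ : Measure X}
    [IsFiniteMeasure μ] {f : X → ℂ} (hf : Continuous f) : Integrable f μ := by
  obtain ⟨C, hC⟩ := isCompact_univ.exists_bound_of_continuousOn hf.continuousOn
  exact Integrable.mono' (integrable_const C) hf.aestronglyMeasurable_of_compactSpace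
    (ae_of_all _ fun x => hC x (Set.mem_univ x))

/-- The Wilson action of the spatial three-torus in the fundamental representation of `SU(3)` is
continuous in the link variables. [folklore] -/
private theorem continuous_wilsonAction_fundamental {S : ℕ} [NeZero S] :
    Continuous (wilsonAction (d := 3) (L := S) (fundamentalRep (Fin 3))) := by
  unfold wilsonAction
  refine continuous_finsetSum _ fun p _ => ?_
  have h1 : Continuous fun U : GaugeConfig 3 S (Matrix.specialUnitaryGroup (Fin 3) ℂ) =>
      plaquetteHolonomy U p.1 p.2.1.1 p.2.1.2 := by
    unfold plaquetteHolonomy; fun_prop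
  exact continuous_const.sub
    (Complex.continuous_re.comp ((continuous_fundamentalRep (Fin 3)).comp h1).matrix_trace)

/-- The pure-gauge transfer kernel `K_β(U, U')` is jointly continuous in `(U, U')` (composition of
`Real.exp`, the continuous Wilson action and matrix-entry polynomials). [folklore] -/
private theorem continuous_gaugeSliceKernel_uncurry {S : ℕ} [NeZero S] (β : ℝ) :
    Continuous fun p : GaugeConfig 3 S (Matrix.specialUnitaryGroup (Fin 3) ℂ) ×
        GaugeConfig 3 S (Matrix.specialUnitaryGroup (Fin 3) ℂ) => gaugeSliceKernel β p.1 p.2 := by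
  unfold gaugeSliceKernel
  refine ((Real.continuous_exp.comp ?_).mul (Real.continuous_exp.comp ?_)).mul
    (Real.continuous_exp.comp ?_)
  · exact continuous_const.mul (continuous_wilsonAction_fundamental.comp continuous_fst)
  · refine (continuous_const.mul (continuous_finsetSum _ fun l _ => ?_)).neg
    have h1 : Continuous fun p : GaugeConfig 3 S (Matrix.specialUnitaryGroup (Fin 3) ℂ) ×
        GaugeConfig 3 S (Matrix.specialUnitaryGroup (Fin 3) ℂ) =>
          (p.1 l : Matrix (Fin 3) (Fin 3) ℂ) :=
      continuous_subtype_val.comp ((continuous_apply l).comp continuous_fst)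
    have h2 : Continuous fun p : GaugeConfig 3 S (Matrix.specialUnitaryGroup (Fin 3) ℂ) ×
        GaugeConfig 3 S (Matrix.specialUnitaryGroup (Fin 3) ℂ) =>
          (p.2 l : Matrix (Fin 3) (Fin 3) ℂ) :=
      continuous_subtype_val.comp ((continuous_apply l).comp continuous_snd)
    exact continuous_const.sub
      (Complex.continuous_re.comp (h1.matrix_mul h2.matrix_conjTranspose).matrix_trace)
  · exact continuous_const.mul (continuous_wilsonAction_fundamental.comp continuous_snd)

/-- **The transfer form is Hermitian** (registered stub `transferForm_conj_symm` of crux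
stmt-QuantumFields-9737): `𝔱(Φ, Ψ) = conj 𝔱(Ψ, Φ)` for continuous wave functions `Φ, Ψ`, given
that the fermionic transfer operator `U ↦ T̂_F(U)` is continuous in the background.  This is the
form-level self-adjointness of `T̂ = T̂_F^{1/2} T̂_U T̂_F^{1/2}`: the kernel `K_β` of `T̂_U` is real
and symmetric (`gaugeSliceKernel_symm`), `conj ⟨a, b⟩ = ⟨b, a⟩`, and the two Haar integrals are
exchanged by Fubini (the integrand is continuous on the compact product of the two slices, hence
integrable for the product of the Haar probability measures).
[cite: Luscher1977, pp. 283–292] [cite: Smit2023, §6.5 (6.87)] -/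
theorem transferForm_conj_symm : ∀ (Nf S : ℕ) [NeZero S] (β : ℝ) (mq : Fin Nf → ℝ), (Continuous fun U : GaugeConfig 3 S (Matrix.specialUnitaryGroup (Fin 3) ℂ) => fermionSliceOp (Nf := Nf) U mq) → ∀ Φ Ψ : SliceWave Nf S, Continuous Φ → Continuous Ψ → transferForm β mq Φ Ψ = (starRingEnd ℂ) (transferForm β mq Ψ Φ) := by
  intro Nf S _ β mq hT Φ Ψ hΦ hΨ
  haveI : IsProbabilityMeasure (sliceHaar S) := by unfold sliceHaar; infer_instance
  -- the swapped integrand, as a function of the pair `(U, U')`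
  set F : GaugeConfig 3 S (Matrix.specialUnitaryGroup (Fin 3) ℂ) →
      GaugeConfig 3 S (Matrix.specialUnitaryGroup (Fin 3) ℂ) → ℂ := fun U U' =>
    (gaugeSliceKernel β U U' : ℂ) *
      (star (fermionSliceOp U' mq *ᵥ Φ U') ⬝ᵥ (fermionSliceOp U mq *ᵥ Ψ U)) with hF
  have hFcont : Continuous (Function.uncurry F) := by
    have hTΦ : Continuous fun U : GaugeConfig 3 S (Matrix.specialUnitaryGroup (Fin 3) ℂ) =>
        fermionSliceOp U mq *ᵥ Φ U := hT.matrix_mulVec hΦ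
    have hTΨ : Continuous fun U : GaugeConfig 3 S (Matrix.specialUnitaryGroup (Fin 3) ℂ) =>
        fermionSliceOp U mq *ᵥ Ψ U := hT.matrix_mulVec hΨ
    exact (Complex.continuous_ofReal.comp (continuous_gaugeSliceKernel_uncurry β)).mul
      ((hTΦ.comp continuous_snd).star.dotProduct (hTΨ.comp continuous_fst))
  have hint : Integrable (Function.uncurry F) ((sliceHaar S).prod (sliceHaar S)) :=
    integrable_of_continuous_of_compactSpace hFcont
  -- conjugate the right-hand side pointwise
  have hconj : (starRingEnd ℂ) (transferForm β mq Ψ Φ) =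
      ∫ U, ∫ U', F U U' ∂(sliceHaar S) ∂(sliceHaar S) := by
    unfold transferForm
    rw [← integral_conj]
    refine integral_congr_ae (ae_of_all _ fun U => ?_)
    simp only
    rw [← integral_conj]
    refine integral_congr_ae (ae_of_all _ fun U' => ?_)
    simp only [hF]
    rw [map_mul, Complex.conj_ofReal, conj_star_dotProduct]
  rw [hconj, integral_integral_swap hint]
  unfold transferForm
  refine integral_congr_ae (ae_of_all _ fun U => ?_)
  refine integral_congr_ae (ae_of_all _ fun U' => ?_)
  simp only [hF]
  rw [gaugeSliceKernel_symm]

/-- **The `T̂_F`-weighted pairing is Hermitian** (registered stub `fermionWeightForm_conj_symm` of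
crux stmt-QuantumFields-9737): for all bare masses `m_f > −1`, `𝔫(Φ, Ψ) = conj 𝔫(Ψ, Φ)` for all
wave functions `Φ, Ψ`.  Pointwise `conj ⟨Ψ(U), T̂_F(U) Φ(U)⟩ = ⟨Φ(U), T̂_F(U)ᴴ Ψ(U)⟩` and
`T̂_F(U)ᴴ = T̂_F(U)` since `T̂_F(U)` is Hermitian positive definite (`fermionSliceOp_posDef`,
Lüscher positivity for `κ < 1/6`); conjugation commutes with the Bochner integral unconditionally.
[cite: Luscher1977, pp. 283–292] [cite: Smit2023, §6.5 (6.87)] -/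
theorem fermionWeightForm_conj_symm : ∀ (Nf S : ℕ) [NeZero S] (mq : Fin Nf → ℝ), (∀ f, -1 < mq f) → ∀ Φ Ψ : SliceWave Nf S, fermionWeightForm mq Φ Ψ = (starRingEnd ℂ) (fermionWeightForm mq Ψ Φ) := by
  intro Nf S _ mq hm Φ Ψ
  unfold fermionWeightForm
  rw [← integral_conj]
  refine integral_congr_ae (ae_of_all _ fun U => ?_)
  exact (conj_star_dotProduct_mulVec_of_isHermitian
    (fermionSliceOp_posDef Nf S U mq hm).isHermitian (Ψ U) (Φ U)).symm

end Summit.QuantumFields.QCD.Cruxes.StableActionBridge.Sketch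

end
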